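import Mathlib
import HarnessLib
import Summits.ValiantsHypothesis.ValiantsHypothesis.Theses.MonotoneRestoration
import Literature.Computability.AlgebraicComplexity.ArithCircuit
import Literature.Computability.AlgebraicComplexity.ArithCircuitProofs
import Literature.Computability.AlgebraicComplexity.MonotoneStructure
import Literature.Computability.AlgebraicComplexity.PermanentIrreducible
import Literature.ModelTheory.FiniteModelTheory.CkEquiv
import Summits.ValiantsHypothesis.ValiantsHypothesis.Theorems.MonotoneRestorationMonotoneRestorationQPCosetCount
import Summits.ValiantsHypothesis.ValiantsHypothesis.Theorems.MonotoneRestorationMonotoneRestorationQPSymmetricLB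
import Summits.ValiantsHypothesis.ValiantsHypothesis.Theorems.MonotoneRestorationMonotoneRestorationQPSupportSymmetrisation
import Summits.ValiantsHypothesis.ValiantsHypothesis.Theorems.MonotoneRestorationMonotoneRestorationQPSparseRegime
import Summits.ValiantsHypothesis.ValiantsHypothesis.Theorems.MonotoneRestorationMonotoneRestorationQPBeta
import Literature.Computability.AlgebraicComplexity.SymmetricArithCircuit
import Literature.Computability.AlgebraicComplexity.DawarWilsenach2025Proofs
import Literature.GroupTheory.PermutationGroups.SmallIndexSubgroups
import Summits.ValiantsHypothesis.ValiantsHypothesis.Theorems.MonotoneRestorationQP.Negative.LoadBearing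
import Summits.ValiantsHypothesis.ValiantsHypothesis.Theorems.MonotoneRestorationMonotoneRestorationQPPermSupportCount

/-! TTRL-lite variant V18992 of stmt-ValiantsHypothesis-15886

Poincaré's step: if `H ≤ G` is core-free (`H.normalCore = ⊥`) then the left-multiplication action
of `G` on `G ⧸ H` is faithful, so `G` embeds in `Equiv.Perm (G ⧸ H)` and `|G|` divides
`[G : H]!`. Mathlib-only: `Subgroup.normalCore_eq_ker`, `MonoidHom.ker_eq_bot_iff`,
`Subgroup.card_dvd_of_injective`, `Nat.card_perm`, `Subgroup.index`.
-/

-- `Summit.ValiantsHypothesis.ValiantsHypothesis.…` is the tree's mandated single-conjunct layout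
-- (Sub = Summit), so the duplicated namespace component is intended.
set_option linter.dupNamespace false

namespace Summit.ValiantsHypothesis.ValiantsHypothesis.Theorems

open Summit.ValiantsHypothesis.ValiantsHypothesis.Theses.MonotoneRestoration
open Literature.Computability.AlgebraicComplexity

/-- TTRL-lite variant V18992 of `stub_altFixing_orbit_dichotomy` (stmt-ValiantsHypothesis-15886),
Poincaré's step: for a finite group `G` and a core-free subgroup `H` (`H.normalCore = ⊥`),
`Nat.card G` divides `(H.index)!` — `G` acts faithfully on `G ⧸ H`, whence an injection
`G →* Equiv.Perm (G ⧸ H)`, and `Nat.card (Equiv.Perm (G ⧸ H)) = (Nat.card (G ⧸ H))! = (H.index)!`. -/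
theorem stub_altFixing_orbit_dichotomy_var18992 :
    ∀ (G : Type) [Group G] [Finite G] (H : Subgroup G),
      H.normalCore = ⊥ → Nat.card G ∣ (H.index).factorial := by
  intro G _ _ H hcore
  have hinj : Function.Injective (MulAction.toPermHom G (G ⧸ H)) := by
    rw [← MonoidHom.ker_eq_bot_iff, ← Subgroup.normalCore_eq_ker]
    exact hcore
  have hdvd : Nat.card G ∣ Nat.card (Equiv.Perm (G ⧸ H)) :=
    Subgroup.card_dvd_of_injective _ hinj
  rwa [Nat.card_perm, ← Subgroup.index] at hdvd

end Summit.ValiantsHypothesis.ValiantsHypothesis.Theorems
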